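import Summits.Ventures.Crystal3D.TopCut.CapD10u58Agg1

/-!
# Cap cut `CapD10u58` (u₀ = -29/50, degree 10): kernel validation of Gram blocks E4, Q0, Q1 (chunk theorems okE4_1, okQ0_1, okQ1_1; cost proxy 0.03 Gbit)

HONEST FRAMING: generated data / kernel-validation file of the venture `Crystal3D` (cell `pub-crystal3d`, phase 2,
seat p2): one piece of the kernel replay of an EXACT Bachoc–Vallentin CAP certificate on `S²` ([BachocVallentin2009]
Theorem 4.4, n = 3; cap level u₀ = -29/50, inner products ≤ 1/2, degree d = 10) solved directly in sum-of-squares form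
(`capfull.py`: CLARABEL float solve → exact rounding → integer identities; certificate `d10_u29over50`, bound value
11.976550 < 12) and checked through `TopCut/CapSOSCheck.lean` + `CapSOSSound.lean` (generic checker + soundness) and the tree's
`ThreePointCert.CheckKron` (Kronecker-packed Gram chunk validation). Nothing geometric is proved in this file; plain lists of
integers / rationals / monomials and `decide +kernel` facts about them (standard axioms only, no `native_decide`).
-/

namespace Summit.Ventures.Crystal3D.TopCut.CapD10u58

open Literature.Geometry.DiscreteGeometry Literature.Geometry.DiscreteGeometry.PolyCert PolyCert.SPoly
open Literature.Geometry.DiscreteGeometry.BachocVallentin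
open Summit.Ventures.PackingBounds.ThreePointCert Summit.Ventures.Crystal3D.CapSOS

set_option maxRecDepth 100000 in
set_option maxHeartbeats 0 in
/-- Block `E4`: rows from 0 (CapD10u58.gE4K.z.length rows) of `zᵀ(LLᵀ)z` added to `[]` give `eE4` (kernel, Kronecker-packed chunk check). [folklore] -/
theorem okE4_1 : chunkOKK CapD10u58.gE4K 0 CapD10u58.gE4K.z.length [] CapD10u58.eE4 = true := by
  decide +kernel

set_option maxRecDepth 100000 in
set_option maxHeartbeats 0 in
/-- Block `Q0`: rows from 0 (CapD10u58.gQ0K.z.length rows) of `zᵀ(LLᵀ)z` added to `[]` give `eQ0` (kernel, Kronecker-packed chunk check). [folklore] -/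
theorem okQ0_1 : chunkOKK CapD10u58.gQ0K 0 CapD10u58.gQ0K.z.length [] CapD10u58.eQ0 = true := by
  decide +kernel

set_option maxRecDepth 100000 in
set_option maxHeartbeats 0 in
/-- Block `Q1`: rows from 0 (CapD10u58.gQ1K.z.length rows) of `zᵀ(LLᵀ)z` added to `[]` give `eQ1` (kernel, Kronecker-packed chunk check). [folklore] -/
theorem okQ1_1 : chunkOKK CapD10u58.gQ1K 0 CapD10u58.gQ1K.z.length [] CapD10u58.eQ1 = true := by
  decide +kernel

end Summit.Ventures.Crystal3D.TopCut.CapD10u58
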